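import Summits.RiemannHypothesis.RiemannHypothesis.Theorems.OddSectorOddBartaFloor
import Summits.RiemannHypothesis.RiemannHypothesis.Theorems.OddSectorOddNegativityOffLine
import HarnessLib

/-!
# `OddOneSignedWindows` implies the Riemann hypothesis
# (helper for crux `OddSector.OddOneSignedWindows`, item stmt-RiemannHypothesis-17778)

With the odd Barta floor (`OddBartaFloor.OddBartaFloor_of`, stmt-17779, RH-free) and the odd
negativity off the line (`oddNegativityOffLine_proof`, stmt-17780, Yoshida's odd criterion in
contrapositive) both landed, the route's deciding theorem `OddSector.closes` turns the remaining crux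
into a sufficient condition for RH: `OddOneSignedWindows → RiemannHypothesis`
(`oddOneSignedWindows_imp_riemannHypothesis`). Equivalently, and slightly more informatively for the
structure of the good-window set: if RH fails then beyond some height NO window carries a one-signed
real odd-sector ground state (`eventually_not_goodWindow_of_not_riemannHypothesis`) — the floor
`ε_od(a) ≥ -e(a)`, `e → 0`, at good windows is incompatible with the uniform negativity
`ε_od(a) ≤ -η` that an off-line zero forces at every large window.

These two theorems are the kernel-checked form of the item's classification "at least as strong as
RH"; the converse `RiemannHypothesis → OddOneSignedWindows` (one-signedness of the odd bottom state at
unboundedly many windows under RH) is open.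
-/

noncomputable section

set_option linter.dupNamespace false

open MeasureTheory Set Filter
open scoped Topology

namespace Summit.RiemannHypothesis.RiemannHypothesis.Theorems.OddSector

open Literature.NumberTheory.LFunctions
open Summit.RiemannHypothesis.RiemannHypothesis.Theses.OddSector

/-- **If RH fails, every large window is bad (registered sub-goal
`eventually_not_goodWindow_of_not_riemannHypothesis` of item stmt-RiemannHypothesis-17778).**
If the Riemann hypothesis is false there is a height `A` such that no window `a ≥ A` carries an
odd-sector Weil ground state that is real and non-negative a.e. on `(0, a)`: `OddNegativityOffLine`
gives `η > 0` and normalised odd tests of energy `≤ -η` at every large window, while the odd Barta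
floor gives `-e(a) ≤ Re Q` at every large good window with `e → 0`. [folklore] -/
theorem eventually_not_goodWindow_of_not_riemannHypothesis :
    ¬ _root_.RiemannHypothesis → ∃ A : ℝ, ∀ a : ℝ, A ≤ a →
      ¬ ∃ u : ℝ → ℂ, IsWeilOddGroundState a u ∧
        ∀ᵐ t : ℝ, t ∈ Ioo 0 a → (u t).im = 0 ∧ 0 ≤ (u t).re := by
  intro hRH
  obtain ⟨η, hη, A, hAneg⟩ := oddNegativityOffLine_proof hRH
  have hBarta := OddBartaFloor.OddBartaFloor_of
  obtain ⟨e, he, a₀, hfloor⟩ := hBarta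
  have hev : ∀ᶠ a in atTop, e a < η := he.eventually (Iio_mem_nhds hη)
  obtain ⟨A₁, hA₁⟩ := eventually_atTop.1 hev
  refine ⟨max (max A a₀) A₁, fun a ha hgood => ?_⟩
  have haA : A ≤ a := le_trans (le_trans (le_max_left _ _) (le_max_left _ _)) ha
  have ha₀ : a₀ ≤ a := le_trans (le_trans (le_max_right _ _) (le_max_left _ _)) ha
  have haA₁ : A₁ ≤ a := le_trans (le_max_right _ _) ha
  obtain ⟨h, hh, hsupp, hodd, hnorm, hneg⟩ := hAneg a haA
  have h1 := hfloor a ha₀ hgood h hh hsupp hodd hnorm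
  have h2 : e a < η := hA₁ a haA₁
  have h3 : -e a ≤ -η := le_trans h1 hneg
  linarith

/-- **`OddOneSignedWindows` implies RH (registered sub-goal
`oddOneSignedWindows_imp_riemannHypothesis` of item stmt-RiemannHypothesis-17778).**
The route's deciding theorem `OddSector.closes` fed with the two landed cruxes
`OddBartaFloor_of` (stmt-17779) and `oddNegativityOffLine_proof` (stmt-17780): a one-signed real
odd-sector ground state at unboundedly many windows implies the Riemann hypothesis. [folklore] -/
theorem oddOneSignedWindows_imp_riemannHypothesis :
    Summit.RiemannHypothesis.RiemannHypothesis.Theses.OddSector.OddOneSignedWindows →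
      _root_.RiemannHypothesis :=
  fun hS => closes OddBartaFloor.OddBartaFloor_of hS oddNegativityOffLine_proof

/-- **The crux is equivalent to its conjunction with RH.** [folklore] -/
theorem oddOneSignedWindows_iff_and_riemannHypothesis :
    Summit.RiemannHypothesis.RiemannHypothesis.Theses.OddSector.OddOneSignedWindows ↔
      Summit.RiemannHypothesis.RiemannHypothesis.Theses.OddSector.OddOneSignedWindows ∧
        _root_.RiemannHypothesis :=
  ⟨fun hS => ⟨hS, oddOneSignedWindows_imp_riemannHypothesis hS⟩, fun h => h.1⟩

end Summit.RiemannHypothesis.RiemannHypothesis.Theorems.OddSector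

end
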